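import Literature.AnabelianGeometry.AbsoluteAnabelian.NeukirchUchidaTheorem
import Literature.NumberTheory.GaloisRepresentations.AbsGaloisInvolutions
import Mathlib.RingTheory.Valuation.RamificationGroup
import HarnessLib

/-!
# Continuous automorphisms of `G_F` permute the decomposition groups of the places of `F̄`

Topic `Literature/NumberTheory/GaloisRepresentations`.  PROOF-ONLY (theorems; no definition, no named
fact).  abc-iut cell, GAP-LEDGER row **G-L4d2g4-1** in its LITERAL wanted form — the decl
`NumberField.absoluteGaloisGroup_aut_mapsTo_decompositionSubgroups` with Mathlib's
`ValuationSubring.decompositionSubgroup` (= `MulAction.stabilizer`, an `abbrev`) — now UNCONDITIONAL: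
the named fact `NeukirchUchida F` of `NeukirchUchida.lean` (abc-iut-w5-d201, p437013) is the theorem
`Literature.AnabelianGeometry.AbsoluteAnabelian.neukirchUchida_holds` (abc-iut-L4-d2, p458975;
sub-DAG `plan/L4/SUBDAG-NeukirchUchida.md` rows R0–R12 + [NSW] (12.1.9) over `ℚ`), and the gap row's
shape was proved from that fact in `NeukirchUchida.exists_map_stabilizer_eq_of_continuousMulEquiv`.
Classical algebraic number theory, outside the [IUTchIII] Cor. 3.12 cone; nothing here takes a side
there.

* `NumberField.absoluteGaloisGroup_aut_mapsTo_decompositionSubgroups` — for a number field `F`, a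
  continuous automorphism `α` of `G_F = Gal(F̄/F)` and a nonarchimedean prime `A ≠ ⊤` of `F̄`
  (a valuation subring), `α(D_A) = D_B` for some nonarchimedean prime `B` of `F̄`
  (Neukirch–Uchida, [NSW] (12.2.1): `α` is conjugation by a field automorphism `τ` of `F̄`; `B = τA`).
* `NumberField.absoluteGaloisGroup_aut_symm_mapsTo_decompositionSubgroups` — the same for `α⁻¹`, i.e.
  every `D_B` is attained: `α` PERMUTES the decomposition groups.
* `NumberField.absoluteGaloisGroup_aut_mapsTo_places` — both clauses of the gap row at once: the
  nonarchimedean permutation above AND the archimedean companion «complex conjugations go to complex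
  conjugations» (Artin–Schreier; `exists_isComplexConjugationAt_map_numberField`, abc-iut-w5-d214
  p435119).

## References
* [NeukirchSchmidtWingberg2008] J. Neukirch, A. Schmidt, K. Wingberg, *Cohomology of Number Fields*
  (2nd ed. 2008), XII §1 (12.1.9), §2 Thm (12.2.1) (Neukirch–Uchida).
* [MochizukiAbsAnab2004] S. Mochizuki, *The absolute anabelian geometry of hyperbolic curves* (2004),
  Thm 1.1.3 p. 6.
* [ArtinSchreier1927Kennzeichnung] E. Artin, O. Schreier, *Eine Kennzeichnung der reell
  abgeschlossenen Körper* (1927), Satz 4.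
-/

noncomputable section

open Field NumberField
open scoped Pointwise

namespace Literature.NumberTheory.GaloisRepresentations

open Literature.AnabelianGeometry.AbsoluteAnabelian (neukirchUchida_holds)

/-- **GAP row G-L4d2g4-1, nonarchimedean clause, LITERAL form, unconditional.**  For a number field
`F`, every continuous automorphism `α` of the absolute Galois group `G_F = Gal(F̄/F)` carries the
decomposition group `D_A ≤ G_F` of a nonarchimedean prime `A` of `F̄` (a valuation subring `A ≠ ⊤`,
`D_A = ValuationSubring.decompositionSubgroup F A`) onto the decomposition group of some
nonarchimedean prime `B` of `F̄`: `α(D_A) = D_B`.  (Neukirch–Uchida: `α = Inn τ` for a field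
automorphism `τ` of `F̄` stabilising `F`-conjugacy data; take `B = τ • A`.)
[cite: NeukirchSchmidtWingberg2008, Thm (12.2.1)] [cite: MochizukiAbsAnab2004, Thm 1.1.3 p.6] -/
theorem NumberField.absoluteGaloisGroup_aut_mapsTo_decompositionSubgroups (F : Type) [Field F]
    [NumberField F] (α : absoluteGaloisGroup F ≃ₜ* absoluteGaloisGroup F)
    (A : ValuationSubring (AlgebraicClosure F)) (hA : A ≠ ⊤) :
    ∃ B : ValuationSubring (AlgebraicClosure F), B ≠ ⊤ ∧
      (A.decompositionSubgroup F).map α.toMulEquiv.toMonoidHom = B.decompositionSubgroup F :=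
  NeukirchUchida.exists_map_stabilizer_eq_of_continuousMulEquiv (neukirchUchida_holds F) α A hA

/-- The inverse direction: every decomposition group `D_B` (`B ≠ ⊤`) is the image `α(D_A)` of some
decomposition group — so `α` PERMUTES the decomposition groups of the nonarchimedean primes of `F̄`
(apply the previous theorem to `α⁻¹` and transport back along `α`).
[cite: NeukirchSchmidtWingberg2008, Thm (12.2.1)] -/
theorem NumberField.absoluteGaloisGroup_aut_symm_mapsTo_decompositionSubgroups (F : Type) [Field F]
    [NumberField F] (α : absoluteGaloisGroup F ≃ₜ* absoluteGaloisGroup F)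
    (B : ValuationSubring (AlgebraicClosure F)) (hB : B ≠ ⊤) :
    ∃ A : ValuationSubring (AlgebraicClosure F), A ≠ ⊤ ∧
      (A.decompositionSubgroup F).map α.toMulEquiv.toMonoidHom = B.decompositionSubgroup F := by
  obtain ⟨A, hA, hAB⟩ :=
    NumberField.absoluteGaloisGroup_aut_mapsTo_decompositionSubgroups F α.symm B hB
  refine ⟨A, hA, ?_⟩
  -- transport `α⁻¹(D_B) = D_A` back along `α`
  have h := congrArg (Subgroup.map α.toMulEquiv.toMonoidHom) hAB
  rw [Subgroup.map_map] at h
  have hid : α.toMulEquiv.toMonoidHom.comp α.symm.toMulEquiv.toMonoidHom = MonoidHom.id _ := by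
    ext σ
    exact α.apply_symm_apply σ
  rw [hid, Subgroup.map_id] at h
  exact h.symm

/-- **GAP row G-L4d2g4-1, both clauses, unconditional.**  For a number field `F` and a continuous
automorphism `α` of `G_F`: (a) `α` carries the decomposition group of every nonarchimedean prime of
`F̄` onto the decomposition group of a nonarchimedean prime (Neukirch–Uchida), and (b) `α` carries
every complex conjugation (at a real place `w` of `F`) to a complex conjugation at some real place
`w'` (Artin–Schreier; abc-iut-w5-d214's `exists_isComplexConjugationAt_map_numberField`).
[cite: NeukirchSchmidtWingberg2008, Thm (12.2.1)]
[cite: ArtinSchreier1927Kennzeichnung, Satz 4 (direct corollary)] -/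
theorem NumberField.absoluteGaloisGroup_aut_mapsTo_places (F : Type) [Field F] [NumberField F]
    (α : absoluteGaloisGroup F ≃ₜ* absoluteGaloisGroup F) :
    (∀ A : ValuationSubring (AlgebraicClosure F), A ≠ ⊤ →
        ∃ B : ValuationSubring (AlgebraicClosure F), B ≠ ⊤ ∧
          (A.decompositionSubgroup F).map α.toMulEquiv.toMonoidHom = B.decompositionSubgroup F) ∧
      ∀ (w : InfinitePlace F) (hw : w.IsReal) (c : absoluteGaloisGroup F),
        IsComplexConjugationAt hw c →
          ∃ (w' : InfinitePlace F) (hw' : w'.IsReal), IsComplexConjugationAt hw' (α c) :=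
  ⟨fun A hA => NumberField.absoluteGaloisGroup_aut_mapsTo_decompositionSubgroups F α A hA,
    fun _ hw c hc => exists_isComplexConjugationAt_map_numberField F α hw c hc⟩

end Literature.NumberTheory.GaloisRepresentations

end
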